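import Literature.AlgebraicGeometry.Frobenioids.GroupLikeStandardExample
import HarnessLib

/-!
# Frobenioids I, §3: Example 3.7 (dilating monoids)

Mochizuki, *The geometry of Frobenioids I: the general theory*, Kyushu J. Math. **62** (2008)
293–400, kurims text pp. 70–71 [cite: MochizukiFrdI2008, Ex. 3.7 pp.70-71].  Sequel to
`GroupLikeStandardExample.lean` (Ex. 3.6: the group `G = ℤ ⊕ ⨁_p ℤ/pℤ`, `F_G`, the one-object
category `D`).

**Example 3.7** (same `G`, `D`; `Φ` = `G × ℤ_{≥0}` with `f ∈ F_G` acting trivially on `G` and by its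
Frobenius degree `d_f` on `ℤ_{≥0}`; `C := F_Φ`, found's `ElemFrobenioid`): `Φ` DEFINED as a genuine
functor `Dᵒᵖ ⥤ CommMonCat`; the printed monoid `M = ℤ_{≥0} × (F_G × F_G)`,
`(a₁, b₁) · (a₂, b₂) = (a₁ + n·m·a₂, b₁ b₂)` DEFINED with its laws PROVED; the factor switch PROVED
to be an automorphism of `M` not preserving base-isomorphisms; the evident bijection `End_C ≃ M`
DEFINED, its `F_G × F_G`-part PROVED multiplicative, and the `ℤ_{≥0}`-part of a product COMPUTED
from Def. 1.1 (iii): it is `d_{Base ψ}·a(φ) + deg_Fr(φ)·a(ψ)`, NOT the printed `a₁ + n·m·a₂`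
(CAVEAT recorded for the referee; the printed identification `EndLawAsPrinted` is typed FALSE-AS-TYPED and REFUTED in-file
(`not_endLawAsPrinted`, RULING P1), and `swapEnd_not_multiplicative` records, kernel-checked, that
the switch is not multiplicative on the actual `End_C`).  Typed: "`Φ` clearly fails to be non-dilating" (over found's
`IsNonDilatingOn`, Def. 1.1 (ii)).

Deliberately NOT here (need Def. 1.2/1.3 and §3 Def. 3.1, seats found/t3): "`C` is a Frobenioid of
Frobenius-normalized and isotropic type, not of group-like type", "preserves pre-steps".
No statement of the paper is strengthened; discrepancies are recorded, not repaired.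
-/

namespace Literature.AlgebraicGeometry.Frobenioids

open CategoryTheory

/-! ### Example 3.7: dilating monoids -/

namespace Ex37

open Ex36 (G FG D)

/-- The action of Ex. 3.7: `f ∈ F_G` with Frobenius degree `d_f` acts on `G × ℤ_{≥0}` "trivially on `G`
and by multiplication by `d_f` on `ℤ_{≥0}`" (multiplicatively: `(g, a) ↦ (g, a^{d_f})`) (p. 70).
[cite: MochizukiFrdI2008, Ex. 3.7 p.70] -/
def act (f : FG) : Multiplicative G × Multiplicative ℕ →* Multiplicative G × Multiplicative ℕ where
  toFun x := (x.1, x.2 ^ (f.degFr : ℕ))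
  map_one' := by simp
  map_mul' x y := by ext <;> simp [mul_pow]

/-- The action is multiplicative in `f` (degrees multiply; the action factors through `N_{≥1}`).
[cite: MochizukiFrdI2008, Ex. 3.7 p.70] -/
theorem act_mul (f f' : FG) : act (f * f') = (act f').comp (act f) := by
  ext x <;> simp [act, pow_mul]

/-- `act 1 = id`. [cite: MochizukiFrdI2008, Ex. 3.7 p.70] -/
theorem act_one : act 1 = MonoidHom.id _ := by
  ext x <;> simp [act]

/-- `Φ`: "the monoid on `D` that associates to the unique object of `D` the monoid `G × ℤ_{≥0}` and to a
morphism `f ∈ F_G` of `D` that projects to `d_f ∈ N_{≥1}` the endomorphism of `G × ℤ_{≥0}` that acts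
trivially on `G` and by multiplication by `d_f` on `ℤ_{≥0}`" (p. 70), as a functor `Dᵒᵖ ⥤ CommMonCat`.
[cite: MochizukiFrdI2008, Ex. 3.7 p.70] -/
def Φ : Dᵒᵖ ⥤ CommMonCat.{0} where
  obj _ := CommMonCat.of (Multiplicative G × Multiplicative ℕ)
  map f := CommMonCat.ofHom (act (show FG from f.unop))
  map_id A := by
    ext x : 2
    change act 1 x = x
    rw [act_one]; rfl
  map_comp f g := by
    ext x : 2
    change act ((show FG from f.unop) * (show FG from g.unop)) x = act _ (act _ x)
    rw [act_mul]; rfl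

/-- `C := F_Φ` (p. 70), found's elementary Frobenioid of `Φ`; its unique object.
[cite: MochizukiFrdI2008, Ex. 3.7 p.70] -/
abbrev obj : ElemFrobenioid Φ := ElemFrobenioid.of Φ (SingleObj.star FG)

/-- "`Φ` clearly fails to be non-dilating" (p. 70; over found's `IsNonDilatingOn`, Def. 1.1 (ii)) —
named statement. [cite: MochizukiFrdI2008, Ex. 3.7 p.70] -/
def NotNonDilating : Prop := ¬ IsNonDilatingOn Φ

/-- The monoid `M` of p. 70: underlying set `ℤ_{≥0} × (F_G × F_G)` with
`(a₁, b₁) · (a₂, b₂) = (a₁ + n·m·a₂, b₁ · b₂)` where `b₁ ↦ (n, m) ∈ N_{≥1} × N_{≥1}`.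
[cite: MochizukiFrdI2008, Ex. 3.7 p.70] -/
@[ext] structure M : Type where
  /-- the `ℤ_{≥0}`-coordinate -/
  a : ℕ
  /-- the `F_G × F_G`-coordinate -/
  b : FG × FG

namespace M

/-- The printed multiplication on `M` (p. 70). [cite: MochizukiFrdI2008, Ex. 3.7 p.70] -/
instance instMonoid : Monoid M where
  mul x y := ⟨x.a + (x.b.1.degFr : ℕ) * (x.b.2.degFr : ℕ) * y.a, x.b * y.b⟩
  one := ⟨0, 1⟩
  mul_assoc x y z := by
    ext : 1
    · show x.a + _ * _ * y.a + ((x.b * y.b).1.degFr : ℕ) * ((x.b * y.b).2.degFr : ℕ) * z.a =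
        x.a + _ * _ * (y.a + _ * _ * z.a)
      simp only [Prod.fst_mul, Prod.snd_mul, ElemFrobenioidMonoid.mul_degFr, PNat.mul_coe]
      ring
    · exact mul_assoc _ _ _
  one_mul x := by
    ext : 1
    · show 0 + ((1 : FG).degFr : ℕ) * ((1 : FG).degFr : ℕ) * x.a = x.a
      simp
    · exact one_mul _
  mul_one x := by
    ext : 1
    · show x.a + _ * _ * 0 = x.a
      simp
    · exact mul_one _

/-- Components of the product in `M`. [cite: MochizukiFrdI2008, Ex. 3.7 p.70] -/
@[simp] theorem mul_a (x y : M) : (x * y).a = x.a + (x.b.1.degFr : ℕ) * (x.b.2.degFr : ℕ) * y.a := rfl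

/-- Components of the product in `M`. [cite: MochizukiFrdI2008, Ex. 3.7 p.70] -/
@[simp] theorem mul_b (x y : M) : (x * y).b = x.b * y.b := rfl

end M

/-- The evident bijection of underlying SETS between the endomorphisms of the unique object of
`C = F_Φ` — triples `(Base ∈ F_G, Div = (g, a) ∈ G × ℤ_{≥0}, deg_Fr = m)` — and `M = ℤ_{≥0} × (F_G × F_G)`,
`(f, (g, a), m) ↦ (a, (f, (g, m)))` (FrdI Ex. 3.7 pp. 70–71). [cite: MochizukiFrdI2008, Ex. 3.7 p.70] -/
def endEquivSet : End obj ≃ M where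
  toFun φ := ⟨Multiplicative.toAdd (ElemFrobenioid.Div φ).2,
    (ElemFrobenioid.Base φ, ⟨(ElemFrobenioid.Div φ).1, ElemFrobenioid.degFr φ⟩)⟩
  invFun x := ElemFrobenioid.homMk x.b.1 (x.b.2.div, Multiplicative.ofAdd x.a) x.b.2.degFr
  left_inv _ := rfl
  right_inv _ := rfl

/-- The `F_G × F_G`-coordinate of `endEquivSet` is multiplicative (Def. 1.1 (iii): bases compose, and
the `G`-part of the divisor together with the Frobenius degree multiply as in `F_G`).
[cite: MochizukiFrdI2008, Ex. 3.7 p.70] -/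
theorem endEquivSet_mul_b (φ ψ : End obj) :
    (endEquivSet (φ * ψ)).b = (endEquivSet φ).b * (endEquivSet ψ).b := by
  refine Prod.ext rfl (ElemFrobenioidMonoid.ext rfl ?_)
  show ElemFrobenioid.degFr ψ * ElemFrobenioid.degFr φ = ElemFrobenioid.degFr φ * _
  exact mul_comm _ _

/-- The `ℤ_{≥0}`-coordinate of a product of endomorphisms of `C = F_Φ` COMPUTED from Def. 1.1 (iii)
(`Div(φ ∘ ψ) = ψ_D^*(Div φ) + deg_Fr(φ) · Div(ψ)`, with `ψ_D^*` = multiplication by `d_{ψ_D}` on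
`ℤ_{≥0}`): `a(φ · ψ) = d_{Base ψ} · a(φ) + deg_Fr(φ) · a(ψ)` (PROVED).  CAVEAT (recorded for the
referee, no repair attempted): the law PRINTED on p. 70 for `M` is `a₁ + n·m·a₂` with `(n, m)` the two
degrees of `b₁`; the computed law differs (e.g. `φ = (1, (1, 1))`, `ψ = (0, (f, 1))` with `d_f = 2`
give `2` here and `1` there), see `EndLawAsPrinted`. [cite: MochizukiFrdI2008, Ex. 3.7 p.70] -/
theorem endEquivSet_mul_a (φ ψ : End obj) :
    (endEquivSet (φ * ψ)).a =
      ((endEquivSet ψ).b.1.degFr : ℕ) * (endEquivSet φ).a + ((endEquivSet φ).b.2.degFr : ℕ) * (endEquivSet ψ).a := by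
  show Multiplicative.toAdd ((act (ElemFrobenioid.Base ψ) (ElemFrobenioid.Div φ)).2 *
      (ElemFrobenioid.Div ψ).2 ^ (ElemFrobenioid.degFr φ : ℕ)) = _
  simp only [act, MonoidHom.coe_mk, OneHom.coe_mk, toAdd_mul, toAdd_pow, smul_eq_mul]
  rfl

/-- FALSE AS TYPED (erratum candidate E1 / printed-claim-under-review; RULING P1): FrdI Ex. 3.7,
"`C` is a one-object category whose unique object has endomorphism monoid `M`" with the law PRINTED
on p. 70 — i.e. the evident bijection `endEquivSet` is multiplicative.  Its `F_G × F_G`-part holds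
(`endEquivSet_mul_b`); its `ℤ_{≥0}`-part does not: the law computed from Def. 1.1 (iii) is
`endEquivSet_mul_a` (the REPAIRED statement, PROVED), and `not_endLawAsPrinted` below refutes the
printed one (witness `(1, (1, 1)) · (0, (f, 1))`, `deg_Fr f = 2`: `2 ≠ 1`).  No re-coordinatisation
`a ↦ c(b)·a` rescues the print here (`ℤ_{≥0}` is not divisible).  Consumers must NOT bind
`(h : EndLawAsPrinted)`. [cite: MochizukiFrdI2008, Ex. 3.7 p.70] -/
def EndLawAsPrinted : Prop := ∀ φ ψ : End obj, endEquivSet (φ * ψ) = endEquivSet φ * endEquivSet ψ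

/-- The printed law is NOT the endomorphism law of `C = F_Φ` (Def. 1.1 (iii)): kernel-checked
refutation of `EndLawAsPrinted` (RULING P1; erratum candidate E1, recorded neutrally — the example is
not cited by [IUTchI–IV]). [cite: MochizukiFrdI2008, Ex. 3.7 p.70] -/
theorem not_endLawAsPrinted : ¬ EndLawAsPrinted := by
  intro h
  let f : FG := ⟨1, 2⟩
  let φ : End obj := endEquivSet.symm ⟨1, (1, 1)⟩
  let ψ : End obj := endEquivSet.symm ⟨0, (f, 1)⟩
  have h1 := congrArg M.a (h φ ψ)
  rw [endEquivSet_mul_a] at h1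
  simp only [φ, ψ, Equiv.apply_symm_apply, M.mul_a] at h1
  exact absurd h1 (by decide)

/-- "by switching the two factors of `F_G`, and keeping the unique factor of `ℤ_{≥0}` fixed, we obtain
an automorphism of the monoid `M`" (p. 71; PROVED for `M` with its printed law).
[cite: MochizukiFrdI2008, Ex. 3.7 p.71] -/
def swapM : M ≃* M where
  toFun x := ⟨x.a, x.b.swap⟩
  invFun x := ⟨x.a, x.b.swap⟩
  left_inv _ := rfl
  right_inv _ := rfl
  map_mul' x y := by
    refine M.ext ?_ rfl
    show (x * y).a = x.a + (x.b.2.degFr : ℕ) * (x.b.1.degFr : ℕ) * y.a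
    rw [M.mul_a, mul_comm (x.b.1.degFr : ℕ)]

/-- "… hence a self-equivalence of `C`, that … fails to preserve base-isomorphisms [cf. Theorem 3.4,
(iii)]" (p. 71; PROVED at the level of `M`: `(0, (1, (0, 2)))` has invertible base component, its
`swapM`-image `(0, ((0, 2), 1))` has base component of Frobenius degree `2`; base-isomorphism =
[FrdI] Def. 1.2 (i)). [cite: MochizukiFrdI2008, Ex. 3.7 p.71] -/
theorem swapM_not_preserves_baseIso :
    ∃ x : M, IsUnit x.b.1 ∧ ¬ IsUnit (swapM x).b.1 := by
  refine ⟨⟨0, (1, ⟨1, 2⟩)⟩, isUnit_one, ?_⟩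
  rw [isUnit_iff_degFr_eq_one]
  exact fun h => absurd (congrArg PNat.val h) (by decide)

/-- The factor switch transported to the endomorphisms of `C = F_Φ` along `endEquivSet`.
[cite: MochizukiFrdI2008, Ex. 3.7 p.71] -/
def swapEnd (φ : End obj) : End obj := endEquivSet.symm (swapM (endEquivSet φ))

/-- Kernel-checked form of the CAVEAT above: on the actual endomorphism monoid of `C = F_Φ`
(Def. 1.1 (iii)) the factor switch is NOT multiplicative — witness `φ = (a=1, (1, 1))`,
`ψ = (a=0, (f, 1))` with `deg_Fr f = 2`: `a(swap(φ·ψ)) = 2 ≠ 1 = a(swap φ · swap ψ)`.  Recorded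
neutrally; the example's intended point (a self-equivalence preserving pre-steps but not
base-isomorphisms) is not evaluated here. [cite: MochizukiFrdI2008, Ex. 3.7 p.71] -/
theorem swapEnd_not_multiplicative : ¬ ∀ φ ψ : End obj, swapEnd (φ * ψ) = swapEnd φ * swapEnd ψ := by
  intro h
  let f : FG := ⟨1, 2⟩
  let φ : End obj := endEquivSet.symm ⟨1, (1, 1)⟩
  let ψ : End obj := endEquivSet.symm ⟨0, (f, 1)⟩
  have h1 := congrArg (fun χ => (endEquivSet χ).a) (h φ ψ)
  have h2 : (endEquivSet (swapEnd φ * swapEnd ψ)).a = 1 := by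
    rw [endEquivSet_mul_a]; rfl
  have h3 : (endEquivSet (swapEnd (φ * ψ))).a = 2 := by
    show (endEquivSet (φ * ψ)).a = 2
    rw [endEquivSet_mul_a]; rfl
  rw [h2, h3] at h1
  exact absurd h1 (by decide)

end Ex37

end Literature.AlgebraicGeometry.Frobenioids
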